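import Summits.FinalStateConjecture.FinalStateConjecture.Theorems.PhotonSphereChannelsChannelsResolveTameDevelopmentsRTrappedSetMinkowskiLimit
import Summits.FinalStateConjecture.FinalStateConjecture.Theorems.PhotonSphereChannelsChannelsResolveTameDevelopmentsRKerrDevExactModels
import Summits.FinalStateConjecture.FinalStateConjecture.Theorems.ChannelsResolveTameDevelopments.Negative.EmptyHorizonEnd
import Literature.Geometry.Lorentzian.SpacetimeKretschmannScalar
import Literature.Geometry.Lorentzian.KerrCurvatureInvariants
import Literature.Geometry.Lorentzian.KerrDataProofs
import Literature.Geometry.Lorentzian.KerrSchildCoord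
import HarnessLib

/-!
# Route PhotonSphereChannels · crux `ChannelsResolveTameDevelopmentsR` (K2R-T2, stmt-FinalStateConjecture-17430) —
# the FLAT END: a certified inhabitant of the hull interface `TameHull.EndDatum.IsTameEnd`, and the
# exclusivity of the Kerr / Minkowski branches on it

The surviving line of the crux (`dark-future-exactness`, crux-triage round 2, `TRIAGE-r2-3.md`) and every
registered rigidity stub of the sibling crux `ChannelsResolveTameDevelopments` are quantified over the posited
interface of `Theorems/PhotonSphereChannelsTameHullDefs.lean`: eternal `(Λ, r₀)`-tame ends
`E : EndDatum 𝓢` with `E.IsTameEnd Λ r₀` (far chart, clock, CENTRED clock-adapted tame balls), silence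
`E.IsSilent` (`KerrDevDefs`), and conclusions of the shape
"`(∃ M a, 0 < M ∧ |a| < M ∧ IsKerrDoc 𝓢 E.doc M a) ∨ IsMinkowski 𝓢`". Up to now NO instance of
`IsTameEnd` had been constructed in the tree (refuters argued with paper witnesses:
`…Negative/EmptyHorizonEnd.lean`, `…Negative/KerrIsolationClosurePoints.lean` take `hW : ∃ …`). This file
supplies the cheapest honest inhabitant and settles the dichotomy on it:

* §1 `exists_isTameEnd_minkowski` — for EVERY class `(Λ, r₀)`, `r₀ > 0`, Minkowski spacetime
  `(ℝ⁴, η, ∂ₜ)` with the far chart the INCLUSION of the eternal cylinder `Kerr.region 0 1 = ℝ_t × {|x| > 1}`,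
  reference mass `M = 0`, bound `C = 0` and clock `x⁰` is a `(Λ, r₀)`-tame end: the far deviation is
  `ι^* η − g_{0,0} = 0` (so `far_bound`, `IsNonRadiating` hold with `0`), `I⁺(cyl) = I⁻(cyl) = ℝ⁴` so
  `doc = ℝ⁴` and the future event horizon is EMPTY (hence `IsSilentHorizon`, `IsRedShifted κ₀` hold
  vacuously and the end `IsSilent`), and the translated identity charts `x ↦ q + x` of `B(0, r₀)` are
  clock-adapted centred tame balls with deviation `0` (all over the landed Minkowski lemmas of
  `…RTrappedSetMinkowskiLimit.lean`, written for the sibling structure `TameEternalLimit`). The end is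
  moreover GLOBALLY `0`-flat (`EndDatum.IsGloballyFlat 0`, identity chart) and not cold.
* §2 `not_isKerrDoc_minkowski` — **no region of Minkowski spacetime is an exact Kerr exterior of positive
  mass**: an `IsKerrDoc` chart `Ψ : Kerr.exterior M a → ℝ⁴` with `Ψ^* η = g_{M,a}` is an isometric immersion
  of the Kerr exterior spacetime, so the Kretschmann scalars agree
  (`Spacetime.kretschmannAt_comp_of_isIsometricImmersion`); Minkowski's vanishes
  (`Minkowski.kretschmannAt_spacetime`) while Kerr's is `48 M²/r⁶ > 0` at an equatorial exterior point
  (`Kerr.kretschmannScalar_closedForm_holds`, `Kerr.kretschmannScalar_equatorial_pos`) — so `M = 0`.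
* §3 `flatEnd_dichotomy_resolves_flat` — on the certified flat tame silent end the rigidity dichotomy holds
  by its MINKOWSKI branch and its KERR branch is FALSE; in particular the conclusion shape of the bridge stub
  `DarkFutureExactnessHull` of the surviving line (`∃ M' a', 0 < M' ∧ |a'| < M' ∧ IsKerrDoc 𝓢 E.doc M' a'`,
  `Cruxes/…/SketchIdeator5.lean`) FAILS on a tame silent end of every class: its slab-closeness hypothesis
  `IsSlabClose` is load-bearing (it must exclude the flat end), a tightness test for the crux-plan seat.

Everything is proved; the only named-fact class met (`[Kerr.Facts]`, analyticity/connectedness of the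
Kerr chart) is discharged inline from `Kerr.isConnected_region_holds`, `Kerr.contMDiff_bilin_holds`,
`Kerr.contMDiff_timeVector_holds`. No new definitions (the witness is built inline; a named
`def flatEndDatum` would be review-queued and is not needed by any consumer).

## References

* B. O'Neill, *Semi-Riemannian geometry* (1983), Ch. 3, Prop. 3.41 (semi-Euclidean space is flat),
  Prop. 3.59 (naturality of curvature), Ch. 4, pp. 97–98. [ONeill1983]
* M. Visser, *The Kerr spacetime: a brief introduction*, arXiv:0706.0622, §3 (Kretschmann scalar). [arXiv07060622]
* R. M. Wald, *General Relativity* (1984), §12.1 (event horizon of an end). [Wald1984]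
* M. T. Anderson, Cheeger–Gromov theory and applications to general relativity (2004), Def. 1.1. [Anderson2004]
-/

noncomputable section

set_option maxSynthPendingDepth 3
set_option linter.dupNamespace false

open Set Filter Function TopologicalSpace Manifold Bundle
open scoped Topology Manifold ContDiff ENNReal NNReal

namespace Summit.FinalStateConjecture.FinalStateConjecture.Theorems.TameHull.FlatEnd

open Literature.Geometry.Lorentzian
open Summit.FinalStateConjecture.FinalStateConjecture.Theorems.TrappedSet
open Summit.FinalStateConjecture.FinalStateConjecture.Theorems.ChannelsResolveTameDevelopments.Negative

/-! ## §1 The flat end is a tame, non-radiating, silent, globally flat end with empty horizon -/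

/-- The clock-adapted centred tame ball of Minkowski spacetime at `q`: the translated inclusion
`x ↦ q + x` of `B(0, r₀)` is a late chart of the Minkowski background over the ball with deviation `0`,
centre `0 ↦ q`, future-directed `∂₀` (it IS `∂ₜ`), reading the clock `x⁰` as `x⁰ + q⁰` — verbatim the
`tame` clause of `EndDatum.IsTameEnd` for the clock `x⁰`, every `Λ`, order `3`. [folklore] -/
theorem tameBall_minkowski (Λ : ℝ≥0) {r₀ : ℝ} (hr₀ : 0 < r₀) (q : E4) :
    let U : Opens E4 := ⟨Metric.ball (0 : E4) r₀, Metric.isOpen_ball⟩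
    ∃ Ψ : U → Minkowski.spacetime.carrier,
      Minkowski.spacetime.IsLateChart (Minkowski.backgroundOn U) Set.univ (-r₀) Ψ ∧
      (∃ x : U, (x : E4) = 0 ∧ Ψ x = q) ∧
      supCkENorm (U : Set E4) 3 (Minkowski.spacetime.deviationExtend (Minkowski.backgroundOn U) Ψ) ≤
          (Λ : ℝ≥0∞) ∧
      supCkENorm (U : Set E4) 0 (Minkowski.spacetime.deviationExtend (Minkowski.backgroundOn U) Ψ) ≤
          1 / 2 ∧
      (∀ x : U, Minkowski.spacetime.timeOrientation.IsFutureDirected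
        (mfderiv 𝓘(ℝ, E4) (𝓡 4) Ψ x (E4.basisVector 0))) ∧
      ∀ x : U, (fun z : E4 ↦ z 0) (Ψ x) = (x : E4) 0 + (fun z : E4 ↦ z 0) q := by
  intro U
  refine ⟨fun y : U ↦ q + (y : E4), isLateChart_minkowski_translate r₀ q,
    ⟨⟨0, Metric.mem_ball_self hr₀⟩, rfl, by simp⟩, ?_, ?_, fun x ↦ ?_, fun x ↦ ?_⟩
  · rw [deviationExtend_minkowski_translate, supCkENorm_zero]
    exact zero_le
  · rw [deviationExtend_minkowski_translate, supCkENorm_zero]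
    exact zero_le
  · exact (congrArg (fun w : E4 ↦
        (TimeOrientation.ofLE (n' := (∞ : ℕ∞ω)) Minkowski.timeOrientation le_top).IsFutureDirected
          (x := q + (x : E4)) w) (mfderiv_translate_subtypeVal_apply U q x (E4.basisVector 0))).mpr
      ((TimeOrientation.ofLE (n' := (∞ : ℕ∞ω)) Minkowski.timeOrientation le_top).isFutureDirected_vectorField _)
  · change (q + (x : E4)) 0 = (x : E4) 0 + q 0
    rw [PiLp.add_apply, add_comm]

/-- **The flat end inhabits the hull interface, in every tameness class.** For all `Λ` and `r₀ > 0`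
there is an end datum `E` of Minkowski spacetime `(ℝ⁴, η, ∂ₜ)` — reference mass `M = 0`, inner radius
`R = 1`, bound `C = 0`, far chart the inclusion of the eternal cylinder `ℝ_t × {|x| > 1}`, clock `x⁰` —
which is a `(Λ, r₀)`-TAME END (`EndDatum.IsTameEnd`), two-sided NON-RADIATING, with EMPTY future event
horizon and domain of outer communications ALL of `ℝ⁴`, SILENT (`EndDatum.IsSilent`: the horizon clauses
hold vacuously, red-shifted branch), GLOBALLY `0`-FLAT (`EndDatum.IsGloballyFlat 0`, identity chart) and
not cold. Anti-vacuity certificate of the hypotheses `E.IsTameEnd Λ r₀ → E.IsSilent → …` of the hull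
rigidity / bridge stubs of cruxes stmt-10046 and stmt-17430 (flat branch). [cite: Anderson2004, Def. 1.1] -/
theorem exists_isTameEnd_minkowski : ∀ (Λ : ℝ≥0) (r₀ : ℝ), 0 < r₀ → ∃ E : EndDatum Minkowski.spacetime, E.M = 0 ∧ E.R = 1 ∧ E.C = 0 ∧ E.IsTameEnd Λ r₀ ∧ E.IsNonRadiating ∧ E.horizon = ∅ ∧ E.doc = Set.univ ∧ E.IsSilent ∧ E.IsGloballyFlat 0 ∧ ¬ E.IsColdHorizon := by
  intro Λ r₀ hr₀
  set E : EndDatum Minkowski.spacetime := ⟨0, 1, 0, Subtype.val, fun x : E4 ↦ x 0⟩ with hE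
  -- the far deviation vanishes identically
  have hh : E.h = 0 := deviationExtend_minkowski_farChart 1
  have hhdot : E.hdot = 0 := by
    funext y
    change fderiv ℝ E.h y (E4.basisVector 0) = 0
    rw [hh]
    simp
  have hhor : E.horizon = ∅ := futureEventHorizonOfEnd_farCylinder_eq_empty 1
  have hdoc : E.doc = Set.univ := docOfEnd_farCylinder_eq_univ 1
  have hnr : E.IsNonRadiating := fun m _ δ hδ ↦ ⟨0, fun x _ ↦ by
    rw [hhdot, iteratedFDeriv_zero (𝕜 := ℝ)]
    simpa using hδ.le⟩
  have htame : E.IsTameEnd Λ r₀ :=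
    { r₀_pos := hr₀
      mass_nonneg := le_rfl
      lt_R := by change max (2 * 0) 0 < (1 : ℝ); norm_num
      vacuum := by
        intro hLC
        haveI : Minkowski.smoothMetric.toPseudoRiemannianMetric.HasLeviCivita := hLC
        exact Minkowski.isRicciFlat_holds
      far_isLocalDiffeomorph := isLocalDiffeomorph_subtypeVal_minkowski _
      far_injective := Subtype.val_injective
      far_bound := fun m _ x ↦ by
        change ‖iteratedFDeriv ℝ m E.h x.1‖ * Kerr.radius 0 x.1 ≤ 0
        rw [hh, iteratedFDeriv_zero (𝕜 := ℝ)]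
        simp
      far_future := fun x ↦
        (congrArg (fun w : E4 ↦
          (TimeOrientation.ofLE (n' := (∞ : ℕ∞ω)) Minkowski.timeOrientation le_top).IsFutureDirected
            (x := (x : E4)) w) (OpensChart.mfderiv_subtypeVal_apply x (E4.basisVector 0))).mpr
          ((TimeOrientation.ofLE (n' := (∞ : ℕ∞ω)) Minkowski.timeOrientation le_top).isFutureDirected_vectorField _)
      clock_smooth := contMDiff_iff_contDiff.mpr (contDiff_piLp_apply (p := 2))
      clock_far := fun _ ↦ rfl
      tame := fun q _ ↦ tameBall_minkowski Λ hr₀ q }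
  have hflat : E.IsGloballyFlat 0 := by
    obtain ⟨Ψ, hbij, hsmooth, hdev, hfut⟩ := isMinkowski_minkowskiSpacetime
    refine ⟨Ψ, hbij.1, hsmooth, ?_, ?_, hfut⟩
    · rw [hdoc]
      exact Set.range_eq_univ.mpr hbij.2
    · have h0 : Minkowski.spacetime.minkowskiDeviation Ψ = 0 := funext hdev
      rw [h0, supCkENorm_zero]
  refine ⟨E, rfl, rfl, rfl, htame, hnr, hhor, hdoc, ?_, hflat, not_isColdHorizon_of_horizon_eq_empty E hhor⟩
  exact ⟨hnr, isSilentHorizon_of_horizon_eq_empty E hhor,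
    Or.inl ⟨1, one_pos, isRedShifted_of_horizon_eq_empty E hhor 1⟩⟩

/-- **The class of tame silent ends is inhabited by a Minkowski space**, in the spacetime-quantified
form of the hull stubs: `∃ 𝓢 E, E.IsTameEnd Λ r₀ ∧ E.IsSilent ∧ IsMinkowski 𝓢`. [cite: Anderson2004, Def. 1.1] -/
theorem exists_tame_silent_minkowski : ∀ (Λ : ℝ≥0) (r₀ : ℝ), 0 < r₀ → ∃ (𝓢 : Spacetime.{0} 4) (E : EndDatum 𝓢), E.IsTameEnd Λ r₀ ∧ E.IsSilent ∧ E.IsNonRadiating ∧ E.horizon = ∅ ∧ IsMinkowski 𝓢 := by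
  intro Λ r₀ hr₀
  obtain ⟨E, -, -, -, htame, hnr, hhor, -, hsil, -⟩ := exists_isTameEnd_minkowski Λ r₀ hr₀
  exact ⟨Minkowski.spacetime, E, htame, hsil, hnr, hhor, isMinkowski_minkowskiSpacetime⟩

/-! ## §2 No region of Minkowski spacetime is an exact Kerr exterior of positive mass -/

/-- An equatorial point of the Kerr exterior: `x = (0, ρ, 0, 0)` with `ρ = |a| + |r₊| + 1` has
Kerr–Schild radius `r` with `r² = ρ² − a² > r₊²`, so `r > max r₊ 0`, and `x₃ = 0`. [cite: arXiv07060622, §3] -/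
theorem exists_equatorial_mem_exterior (M a : ℝ) :
    ∃ x : E4, x ∈ (Kerr.exterior M a : Set E4) ∧ x 3 = 0 := by
  set ρ : ℝ := |a| + |Kerr.rPlus M a| + 1 with hρ
  set x : E4 := (WithLp.equiv 2 (Fin 4 → ℝ)).symm ![0, ρ, 0, 0] with hx
  have hx1 : x 1 = ρ := rfl
  have hx0 : x 0 = 0 := rfl
  have hx2 : x 2 = 0 := rfl
  have hx3 : x 3 = 0 := rfl
  have hρpos : 0 < ρ := by positivity
  have hsn : E4.spatialNorm x = ρ := by
    rw [E4.spatialNorm, EuclideanSpace.norm_eq]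
    simp only [E4.spatial_apply, Fin.sum_univ_three, Real.norm_eq_abs, sq_abs]
    rw [show x (Fin.succ 0) = ρ from hx1, show x (Fin.succ 1) = 0 from hx2,
      show x (Fin.succ 2) = 0 from hx3]
    simp only [ne_eq, OfNat.ofNat_ne_zero, not_false_eq_true, zero_pow, add_zero]
    exact Real.sqrt_sq hρpos.le
  have hρa : a ^ 2 ≤ ρ ^ 2 := by
    rw [sq_le_sq, abs_of_pos hρpos, hρ]
    linarith [abs_nonneg (Kerr.rPlus M a)]
  have hr2 : Kerr.radius a x ^ 2 = ρ ^ 2 - a ^ 2 := by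
    rw [Kerr.radius, Real.sq_sqrt, hsn, hx3]
    · have : (ρ ^ 2 - a ^ 2) ^ 2 + 4 * a ^ 2 * 0 ^ 2 = (ρ ^ 2 - a ^ 2) ^ 2 := by ring
      rw [this, Real.sqrt_sq (sub_nonneg.mpr hρa)]
      ring
    · rw [hsn, hx3]
      have : (ρ ^ 2 - a ^ 2) ^ 2 + 4 * a ^ 2 * 0 ^ 2 = (ρ ^ 2 - a ^ 2) ^ 2 := by ring
      rw [this, Real.sqrt_sq (sub_nonneg.mpr hρa)]
      linarith [sub_nonneg.mpr hρa]
  refine ⟨x, ?_, hx3⟩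
  rw [Kerr.exterior, SetLike.mem_coe, Kerr.mem_region]
  have hrnn : 0 ≤ Kerr.radius a x := Kerr.radius_nonneg a x
  have hlt : max (Kerr.rPlus M a) 0 ^ 2 < Kerr.radius a x ^ 2 := by
    rw [hr2]
    have hm : max (Kerr.rPlus M a) 0 ≤ |Kerr.rPlus M a| :=
      max_le (le_abs_self _) (abs_nonneg _)
    have hm0 : 0 ≤ max (Kerr.rPlus M a) 0 := le_max_right _ _
    nlinarith [abs_nonneg a, abs_nonneg (Kerr.rPlus M a), sq_abs a]
  exact lt_of_pow_lt_pow_left₀ 2 hrnn hlt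

/-- **No region of Minkowski spacetime is an exact Kerr exterior of positive mass.** If
`Ψ : Kerr.exterior M a → ℝ⁴` is injective, smooth, with `Ψ^* η = g_{M,a}` exactly (`IsKerrDoc`), then
`Ψ` is an isometric immersion of the Kerr exterior spacetime `(Kerr.region a r₊, g_{M,a})` into
`(ℝ⁴, η)`, so the Kretschmann scalars agree along `Ψ` (`Spacetime.kretschmannAt_comp_of_isIsometricImmersion`);
but `|Rm|²(η) = 0` (`Minkowski.kretschmannAt_spacetime`) while `|Rm|²(g_{M,a}) = 48 M²/r⁶ > 0` at an
equatorial exterior point (`Kerr.kretschmannScalar_closedForm_holds`) — impossible for `M > 0`.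
[cite: arXiv07060622, §3] -/
theorem not_isKerrDoc_minkowski : ∀ {O : Set Minkowski.spacetime.carrier} {M a : ℝ}, 0 < M → ¬ IsKerrDoc Minkowski.spacetime O M a := by
  intro O M a hM
  rintro ⟨Ψ, -, hsmooth, -, hdev, -⟩
  haveI : Kerr.Facts :=
    ⟨Kerr.isConnected_region_holds, Kerr.contMDiff_bilin_holds, Kerr.contMDiff_timeVector_holds⟩
  set 𝓚 : Spacetime.{0} 4 := Kerr.spacetime M a (Kerr.rPlus M a) hM.le with h𝓚
  -- `Ψ` is an isometric immersion `𝓚 → (ℝ⁴, η)`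
  have hE : 𝓚.metric.IsIsometricImmersion Minkowski.spacetime.metric.toPseudoRiemannianMetric Ψ := by
    refine ⟨hsmooth, fun y ↦ ?_⟩
    have h := hdev y
    rw [Spacetime.deviation, sub_eq_zero] at h
    exact h
  obtain ⟨x, hx, hx3⟩ := exists_equatorial_mem_exterior M a
  have hcomp := Spacetime.kretschmannAt_comp_of_isIsometricImmersion (𝓢 := Minkowski.spacetime)
    (𝓤 := 𝓚) hE ⟨x, hx⟩
  rw [Minkowski.kretschmannAt_spacetime] at hcomp
  -- read `𝓚.kretschmannAt` in the inclusion chart: it is `|Rm|²(g_{M,a})` at `x` (both equal the closed form)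
  have hK : 𝓚.kretschmannAt ⟨x, hx⟩ = MetricCoord.rmNormSqAt (Kerr.bilin M a) x :=
    (Kerr.kretschmannAt_spacetime Kerr.kretschmannScalar_closedForm_holds M a (Kerr.rPlus M a) hM.le
      ⟨x, hx⟩).trans
      (Kerr.kretschmannScalar_closedForm_holds M a x (Kerr.radius_pos_of_mem_region hx)).symm
  have hpos : 0 < MetricCoord.rmNormSqAt (Kerr.bilin M a) x :=
    Kerr.kretschmannScalar_equatorial_pos Kerr.kretschmannScalar_closedForm_holds hM.ne' a
      (Kerr.radius_pos_of_mem_region hx) hx3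
  exact hpos.ne (hcomp.trans hK)

/-! ## §3 On the flat end the Kerr / Minkowski dichotomy resolves to the flat branch only -/

/-- **The rigidity dichotomy on the flat end.** For every class `(Λ, r₀)`, `r₀ > 0`, there is a tame,
silent end `E` of a spacetime `𝓢` (Minkowski space with the cylinder end) on which the conclusion
"`(∃ M a, 0 < M ∧ |a| ≤ M ∧ IsKerrDoc 𝓢 E.doc M a) ∨ IsMinkowski 𝓢`" of the hull rigidity stubs holds by
its MINKOWSKI branch while its KERR branch is FALSE (even with `|a| ≤ M`): the two branches are
exclusive on the certified witness, and the conclusion shape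
`∃ M' a', 0 < M' ∧ |a'| < M' ∧ IsKerrDoc 𝓢 E.doc M' a'` of the bridge stub `DarkFutureExactnessHull`
(line `dark-future-exactness`) fails on a tame silent end — its slab-closeness hypothesis must exclude
the flat end. [cite: arXiv07060622, §3] -/
theorem flatEnd_dichotomy_resolves_flat : ∀ (Λ : ℝ≥0) (r₀ : ℝ), 0 < r₀ → ∃ (𝓢 : Spacetime.{0} 4) (E : EndDatum 𝓢), E.IsTameEnd Λ r₀ ∧ E.IsSilent ∧ IsMinkowski 𝓢 ∧ (¬ ∃ M a : ℝ, 0 < M ∧ |a| ≤ M ∧ IsKerrDoc 𝓢 E.doc M a) ∧ ¬ ∃ M' a' : ℝ, 0 < M' ∧ |a'| < M' ∧ IsKerrDoc 𝓢 E.doc M' a' := by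
  intro Λ r₀ hr₀
  obtain ⟨E, -, -, -, htame, -, -, -, hsil, -⟩ := exists_isTameEnd_minkowski Λ r₀ hr₀
  exact ⟨Minkowski.spacetime, E, htame, hsil, isMinkowski_minkowskiSpacetime,
    fun ⟨M, a, hM, _, hK⟩ ↦ not_isKerrDoc_minkowski hM hK,
    fun ⟨M, a, hM, _, hK⟩ ↦ not_isKerrDoc_minkowski hM hK⟩

end Summit.FinalStateConjecture.FinalStateConjecture.Theorems.TameHull.FlatEnd

end
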